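import Summits.CriticalPhenomena.Ising3D.Control2DL15BoxPTable
import Mathlib.Tactic.NormNum
import HarnessLib

/-!
# RB-2 certificate `j129649_functional_deriv2d_L15_E040_sig1o8_box0.30-0.37.json` (Λ = 15, E₀ = 40): Δ_ε ∉ [3/10, 37/100] at Δ_σ = 1/8 under A2D′ — (R), the large-`S` half, in the kernel
(cell `pub-ising3x`, seat controls-1 gen 18; KERNEL PATH for the 2D γ-certificates, Λ = 15 — CONTROL-ONLY)

HONEST FRAMING: lottery ticket; floor = tightest certified 3D Ising CFT bounds; no exact-solution
claim without a proof. CONTROL-ONLY (`d = 2`, `Δ_σ = 1/8`, the 2D Ising control; axiom set `A2D′`).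

(R) `region_boxP` for the table `wtboxP` (`Control2DL15BoxPTable`): the compactified region polynomial `QhatboxP`
(`S₁ = 80`, `d = 15`) is non-negative on `τ ∈ [0,1]`, `v ∈ [0,1]` by the tensor-Bernstein SHAPE tree `cregboxP`
(1 leaves; every Bernstein coefficient computed and decided in the kernel, `Control2DPolyCertAuto2`, in 1 chunks of
≤ 12 leaves re-assembled along the splits), and `S ≤ S₁` by the per-`J` shapes `cregJboxP` of the Table file;
`region_of_kernelCertAuto` turns the two kernel facts into hypothesis `hR` verbatim. No facts, standard axioms only.
-/

namespace Summit.CriticalPhenomena.Ising3D.Control2D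

open Literature.MathematicalPhysics.QuantumFieldTheory.ConformalBootstrap3D

set_option maxHeartbeats 0 in
set_option maxRecDepth 200000 in
/-- Chunk 0 of the large-`S` tree (box `q₁=1, a₁=0; q₂=1, a₂=0`; 1 leaves), decided in the kernel. [folklore] -/
theorem cregboxP_n0 :
    checkAuto₂ QhatboxP 16 1 0 1 1 0 1
    (Shape₂.leaf) = true := by
  decide +kernel

/-- Tensor-Bernstein tree SHAPE for the compactified region polynomial on `[0,1] × [0,1]` (`S₁ = 80`; 1 leaves). [folklore] -/
def cregboxP : Shape₂ :=
  Shape₂.leaf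

/-- **Kernel check of the large-`S` certificate** (assembled from the 1 chunks). [folklore] -/
theorem cregboxP_ok : checkAuto₂ QhatboxP 16 1 0 1 1 0 1 cregboxP = true :=
  cregboxP_n0

/-- **(R) for the table** (hypothesis `hR` of the explicit certificate theorems, `E₀ = 40`, `s = 1/8`): every
inequality re-decided in the kernel. [folklore] -/
theorem region_boxP (b : ℝ) (J : ℕ) (hb : 0 ≤ b) (hE : (40 : ℝ) ≤ 2 * b + J) :
    0 ≤ ∑ p ∈ slL15.toFinset, (wtboxP p : ℝ) * ((1 - (-1 : ℝ) ^ (p.1 + p.2)) * 2 ^ (p.1 + p.2) *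
      (qFactor₁ (1 / 8) (b + J) p.1 * qFactor₁ (1 / 8) b p.2 +
        qFactor₁ (1 / 8) b p.1 * qFactor₁ (1 / 8) (b + J) p.2)) :=
  region_of_kernelCertAuto wtboxP slL15_nodup slL15_deg 15 16 (by norm_num) (by norm_num) PregboxP_eq
    (by decide +kernel) QhatboxP_eq cregboxP cregboxP_ok cregJboxP (by decide) cregJboxP_ok b J hb
    (by exact_mod_cast hE)

end Summit.CriticalPhenomena.Ising3D.Control2D
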